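import Literature.MathematicalPhysics.QuantumFieldTheory.Balaban1983to89.B8Eq155JBound

/-!
# `Balaban1983to89.B9Eq340HolderZd` — T. Bałaban, *Propagators for lattice gauge theories in a background field*, Commun.
# Math. Phys. **99** (1985) 389–434 [Balaban1985BackgroundPropagators], p. 397: the COVARIANT HÖLDER SEMINORMS (3.40)
# «‖A‖_α = max_μ sup_{x,x′:|x−x′|≦1} |x′ − x|^{−α}|R(U(Γ_{x,x′}))A_μ(x′) − A_μ(x)|», «‖A‖_{1,α} = ‖∇A‖_α» DEFINED on the concrete
# `ℤᵈ` carriers of the B7/B8 lineage, with the transport R(U(Γ_{x,x′})) along the staircase contour CONSTRUCTED from U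
# (definitions with bodies + kernel-checked API: shortest contour, flat and one-step cases, gauge invariance, boundedness)

statement-level skeleton of published theorems with citation tags; proofs where landed; nothing here is a claim about the Yang–Mills mass gap

PDF held: `paper:balaban1985-cmp99-background-propagators` (journal page = PDF page + 388); page read for this module AS IMAGE:
render `run/shared/lean/pub/pub-balaban/b2b-balaban-ref1/pages/1985-cmp99-background-propagators/…-p009-x2.png` (p. 397:
(3.39)–(3.41) and the Theorem 3.1 lead-in); [2] = [Balaban1984PropagatorsI] (1.109) p. 35, [3] = [Balaban1985Averaging] (8)–(9)
p. 18, (56) p. 27, p. 24, and [Balaban1985RegularSpaces] (1.1) p. 76, (1.11) p. 77, (1.17)–(1.18) p. 78, (1.36) p. 82, (1.41) p. 83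
through the tree modules named below.

CITATION HEADER (lean-in-tree rule).  Cell `lit-balaban` (HOME `run/shared/lean/pub/lit-balaban/`), unit `lit-balaban-p40` gen 8
(Phase-2 proof seat p40; free-target protocol G.5-34(d), TAKING HOME/STATUS 2026-08-21T18:51:07Z; B9 fold owner r06, B8 fold
owner r05, referee ref-4); v1.1 docfix p40 gen 15 (literature-prover-lit-balaban-p40-g15-0): page numeral «(1.36) p. 82» (print:
(1.36)–(1.38) p. 82 [PDF 8]; r12 CITELOC §8 / r05 QUOTE-AUDIT-B8 §3), declarations unchanged.  WHAT IS REPRODUCED = the OBJECT of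
SKELETON row **`B9.Eq3.39`** ((3.39)–(3.41) p. 397; cell status
«typed-existing — (abstract carriers; concrete (3.40) only in B11's file)», decls of record `B9.Geometry.holder` (abstract field),
`B11HolderComplex.HolderOn` (bound PREDICATE, plain differences), `LatticeNorms.holderSeminormB9` (r19: generic FINITE-REGION shape
`Finset`-carried with a user-supplied transport `τ`, instantiated nowhere with a covariant transport)) ON THE `ℤᵈ` LINEAGE CARRIERS
of `B7Prop1Explicit`/`B8Ineq132`/`B8Eq155JBound` (`Site d = Fin d → ℤ`, bond fields `A : Site d → Fin d → 𝔸`, backgrounds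
`U₀ : Site d → Fin d → 𝔸ˣ`), i.e. the cell's interface need I-B8-3 («the Hölder seminorm ‖A‖_{1,β} of (1.36)/(1.62)»,
`lit-balaban-r05/INTERFACES-B8.md`; consumer: the sibling `B8Prop3Holder` = [Balaban1985RegularSpaces] Prop. 3's Hölder member).
Kind: definitions with bodies (`trans`, `AdmPair`, `hquot`, `holder0`, `holder1`, `l1Len`, `euclidLen`) and kernel-checked
theorems; no `… : Prop` fact; no existing module is modified; 0 sorry.  REUSED BY NAME: `B7Prop1Explicit.hol/treeWord/gaugeAct/
hol_gaugeAct/disp_treeWord/length_treeWord/l1_disp_le/hol_mem/seg_natCast`, `B8Ineq130.hol_one`, `B8Lemma1NonAbelian.treeWord_zsmul_e`,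
`B7Eq78Linearization.conjR(_sub/_smul_real)`, `B8Ineq132.covDerivFwd/conjR_conjR/one_conjR/norm_conjR`,
`B8Eq155JBound.gradNorm2/norm_covDerivFwd_le_gradNorm2`.

WHAT IS PRINTED (p. 397 [PDF 9], verbatim from the render).  *"To formulate the regularity and decay properties we have to
introduce several norms. They are identical to the norms used in [3, 4], e.g., given by (1.108), (1.109), but the derivatives
there have to be replaced by the corresponding covariant derivatives determined by a configuration U. Thus we have the supremum
norms |A| = max_μ sup_x |A_μ(x)|, |∇A| = max_{μ,ν} sup_x |(D_μA_ν)(x)|, (3.39) and the Hölder norms ‖A‖_α = max_μ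
sup_{x,x′:|x−x′|≦1} |x′ − x|^{−α}|R(U(Γ_{x,x′}))A_μ(x′) − A_μ(x)|, (3.40) ‖A‖_{1,α} = ‖∇A‖_α = max_{μ,ν} sup_{x,x′:|x−x′|≦1}
|x′ − x|^{−α}|R(U(Γ_{x,x′}))(D_μA_ν)(x′) − (D_μA_ν)(x)|, where Γ_{x,x′} is a shortest contour connecting points x and x′. It is
understood that the η-scale is used in the above definitions. … Thus the norm |A|_(α) can be defined as the smallest number C such,
that |A(b)| ≦ C(Lʲη)^α for b ∈ Ω_j∖Ω_{j+1}, j = 0, 1, …, k."*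

DICTIONARY.  «R(U(Γ_{x,x′}))X» ↦ `trans U₀ x x' X = conjR (hol U₀ x (treeWord (x' − x))) X`: the parallel transport (9) of [3]
along the STAIRCASE contour `B7Prop1Explicit.treeWord` (= Γ_{y,x} of [2] (1.7) / [3] p. 24 — a shortest contour,
`length_treeWord_le_of_disp_eq`), acting by the adjoint action `conjR` ((56) of [3] = the R of [Balaban1985RegularSpaces] p. 76).
«x, x′ : |x − x′| ≦ 1» (η-scale) ↦ `AdmPair η len` = the pairs with `0 < len (x' − x)` and `η·len (x' − x) ≤ 1` for a length
function `len : ℤᵈ → ℝ` (print does not name the norm |·| on ηℤᵈ; every theorem holds for EVERY `len`; the Euclidean reading is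
`euclidLen`, the contour-length reading `l1Len`).  «|x′ − x|^{−α}|…|» ↦ `hquot` = `‖…‖ / (η·len(x' − x))^α`.  «‖A‖_α» ↦ `holder0`,
«‖A‖_{1,α} = ‖∇A‖_α» ↦ `holder1 η α len U₀ A` = `⨆` over `(μ, ν, admissible pair)` of the quotients of the components
`D^η_{U₀,μ}A_ν` = `B8Ineq132.covDerivFwd η U₀ μ (A · ν)` ([Balaban1985RegularSpaces] (1.1), the lineage's forward covariant
derivative) — value `0` for an unbounded or empty family, the convention of `B8Eq155JBound.wsup`; the sup over `x` is GLOBAL on `ℤᵈ`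
(the lineage's one-level reading, `B8Eq155JBound`/`B8Prop3Concrete` HONEST SCOPE (i)).  «U ↦ U^u» ↦ `B7Prop1Explicit.gaugeAct`;
«A ↦ R(u)A» ([Balaban1985RegularSpaces] (1.18) «^uU′(x, x′) = R(u(x))U′(x, x′)» for U′ = e^{iηA}) ↦ `fun z ν => conjR (u z) (A z ν)`.

WHAT THIS FILE PROVES (kernel, no `sorry`, axioms ⊆ {propext, Classical.choice, Quot.sound}).  §1 the transport:
`length_treeWord_le_of_disp_eq` («Γ_{x,x′} is a shortest contour»: no lattice contour from x to x′ is shorter than the staircase),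
`trans_self`, `trans_flat` (U = 1 ⇒ R = id: (3.40) is then the plain quotient of [2] (1.109) = `LatticeNorms.holderSeminormB5`'s
shape), `trans_sub`, `trans_smul`, `norm_trans` (isometry for `U1`-valued U), `trans_step` (one forward step = the transport
R(U(x, x+e_μ)) inside (1.1)), **`trans_gaugeAct`** ((8) of [3] along Γ_{x,x′}), **`covDerivFwd_gaugeAct`** (the forward twin of the
tree's (1.11) `B8Ineq132.covDeriv_gaugeAct`).  §2 the seminorms: `holder1_le`/`hquot_le_holder1` («the smallest number C such
that …»), `holder1_nonneg`, **`hquot_gaugeAct`**, **`holder1_gaugeAct`**, **`holder0_gaugeAct`** (GAUGE INVARIANCE of (3.40) under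
U ↦ U^u, A ↦ R(u)A for `U1`-valued u — the Hölder companion of [Balaban1985RegularSpaces] p. 77 «These conditions are invariant with
respect to gauge transformations»), `hquot_flat`, **`hquot_le_of_141`** (under [Balaban1985RegularSpaces] (1.41) `|A| ≦ α₂(Lʲη)⁻¹`
every (1,α)-quotient is ≦ 2((Lʲη)⁻¹)²|∇^η_UA|_(−2)·η^{−α}, so `holder1` is a genuine supremum); `one_le_l1Len`, `one_le_euclidLen`
(a non-zero lattice length is ≥ 1).

HONEST SCOPE.  (i) «a shortest contour»: the staircase IS one (`length_treeWord_le_of_disp_eq`), but print does not say WHICH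
shortest contour; for a non-flat U the value of (3.40) depends on that choice (by a plaquette-size amount) — this file fixes [2]
(1.7)'s staircase, the contour the whole lineage uses (`B7Prop1Explicit.axialFn`).  (ii) The norm |x′ − x| on ηℤᵈ is a parameter
`len`.  (iii) Print's exponent letters α / β are the same slot (B8 writes β); any real is allowed, `0 ≤ ·` only where quotients are
compared.  (iv) The supremum is the lineage's global `⨆` (one level); the multi-level «on Ω_j» localisation of (3.41) is not
re-examined (cell reading G-adv8-11/G-B8-16).  (v) Nothing of Theorems 3.1–3.3 (the BOUNDS in these norms) is touched — interface
need I-B8-2, r06's lane.  Value = a concrete typed object the interface list asks for + its elementary API; NOT summit progress.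
-/

namespace Literature.MathematicalPhysics.QuantumFieldTheory.Balaban1983to89.B9Eq340HolderZd

-- bare `Site d` must be the `ℤᵈ` carrier `B7Prop1Explicit.Site`, not the torus `Balaban1983to89.Site` of `Setup`
export B7Prop1Explicit (Site)
open B7Prop1Explicit (U1 e Letter hol treeWord disp disp_treeWord length_treeWord l1 l1_disp_le gaugeAct hol_gaugeAct
  hol_mem hol_cons hol_nil stepHol_true seg seg_natCast)
open B7Eq78Linearization (conjR conjR_apply conjR_sub conjR_smul_real)
open B8Lemma1NonAbelian (treeWord_zsmul_e)
open B8Ineq132 (covDerivFwd conjR_conjR one_conjR norm_conjR)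
open B8Eq155JBound (gradNorm2 gradNorm2_nonneg norm_covDerivFwd_le_gradNorm2)

noncomputable section

variable {d : ℕ}

/-! ## §1 The transport «R(U₀(Γ_{x,x′}))» of [4] (3.40) along the staircase contour -/

section Transport

variable {𝔸 : Type*} [NormedRing 𝔸]

/-- **«R(U(Γ_{x,x′}))»** of [4] (3.40): the value `X` at the site `x'` transported to `x` by the adjoint action (56) of [3] of
the parallel transport (9) of [3] of `U₀` along the staircase contour `Γ_{x,x′}` = `treeWord (x' − x)` spelled from `x` ([2] (1.7)).
[cite: Balaban1985BackgroundPropagators, (3.40) p.397; Balaban1985Averaging, (9) p.18, (56) p.27] -/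
def trans (U₀ : Site d → Fin d → 𝔸ˣ) (x x' : Site d) (X : 𝔸) : 𝔸 :=
  conjR (hol U₀ x (treeWord (x' - x))) X

/-- unfolding of `trans`. [cite: Balaban1985BackgroundPropagators, (3.40) p.397] -/
theorem trans_def (U₀ : Site d → Fin d → 𝔸ˣ) (x x' : Site d) (X : 𝔸) :
    trans U₀ x x' X = conjR (hol U₀ x (treeWord (x' - x))) X := rfl

omit [NormedRing 𝔸] in
/-- **«Γ_{x,x′} is a shortest contour connecting points x and x′»** ([4] p. 397): the staircase from `x` to `x'` has
`|x′ − x|₁` bonds, and no lattice contour from `x` to `x'` (a word `w` with displacement `x' − x`) has fewer.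
[cite: Balaban1985BackgroundPropagators, (3.40) p.397] -/
theorem length_treeWord_le_of_disp_eq (x x' : Site d) (w : List (Letter d)) (hw : disp w = x' - x) :
    (treeWord (x' - x)).length ≤ w.length := by
  rw [length_treeWord, ← hw]
  exact l1_disp_le w

omit [NormedRing 𝔸] in
/-- The staircase has exactly `|x′ − x|₁ = Σ_μ |x′_μ − x_μ|` bonds. [cite: Balaban1985BackgroundPropagators, (3.40) p.397] -/
theorem length_treeWord_eq (x x' : Site d) : (treeWord (x' - x)).length = l1 (x' - x) :=
  length_treeWord _

/-- `R(U₀(Γ_{x,x})) = id` (empty contour: the excluded diagonal `x = x′` of (3.40)). [cite: Balaban1985BackgroundPropagators, (3.40) p.397] -/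
@[simp] theorem trans_self (U₀ : Site d → Fin d → 𝔸ˣ) (x : Site d) (X : 𝔸) : trans U₀ x x X = X := by
  simp [trans, one_conjR]

/-- **Flat background**: for `U₀ = 1` the transport is the identity, so (3.40) is the plain Hölder quotient of [2] (1.109)
(«They are identical to the norms used in [3, 4], e.g., given by (1.108), (1.109), but the derivatives there have to be
replaced by the corresponding covariant derivatives», [4] p. 397). [cite: Balaban1985BackgroundPropagators, p.397; Balaban1984PropagatorsI, (1.109) p.35] -/
@[simp] theorem trans_flat (x x' : Site d) (X : 𝔸) : trans (1 : Site d → Fin d → 𝔸ˣ) x x' X = X := by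
  rw [trans, B8Ineq130.hol_one, one_conjR]

/-- `R(U₀(Γ))` is additive (R(X)Y = XYX⁻¹, (56)–(57) of [3]). [cite: Balaban1985Averaging, (56)–(57) p.27] -/
theorem trans_sub (U₀ : Site d → Fin d → 𝔸ˣ) (x x' : Site d) (X Y : 𝔸) :
    trans U₀ x x' (X - Y) = trans U₀ x x' X - trans U₀ x x' Y :=
  conjR_sub _ _ _

/-- **One forward step**: for the bond `⟨x, x + e_μ⟩` the staircase is that bond and `R(U₀(Γ_{x,x+e_μ})) = R(U₀(x, x+e_μ))`, the
transport inside the forward covariant derivative (1.1) (`B8Ineq132.covDerivFwd`). [cite: Balaban1985RegularSpaces, (1.1) p.76] -/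
theorem trans_step (U₀ : Site d → Fin d → 𝔸ˣ) (x : Site d) (μ : Fin d) (X : 𝔸) :
    trans U₀ x (x + e μ) X = conjR (U₀ x μ) X := by
  have htw : treeWord (e μ : Site d) = [(μ, true)] := by
    have h := treeWord_zsmul_e (d := d) 1 μ
    rw [one_zsmul] at h
    rw [h]
    exact seg_natCast μ 1
  rw [trans, add_sub_cancel_left, htw, hol_cons, hol_nil, mul_one, stepHol_true]

/-- **(8) of [3] along `Γ_{x,x′}`**: `R(U₀^u(Γ_{x,x′}))X = R(u(x)) R(U₀(Γ_{x,x′})) R(u(x′))⁻¹ X`.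
[cite: Balaban1985Averaging, (8) p.18; Balaban1985RegularSpaces, (1.17) p.78] -/
theorem trans_gaugeAct (u : Site d → 𝔸ˣ) (U₀ : Site d → Fin d → 𝔸ˣ) (x x' : Site d) (X : 𝔸) :
    trans (gaugeAct u U₀) x x' X = conjR (u x) (trans U₀ x x' (conjR (u x')⁻¹ X)) := by
  rw [trans, trans, hol_gaugeAct, disp_treeWord, add_sub_cancel, conjR_conjR, conjR_conjR]

/-- `R(U₀(Γ))` is an isometry for `U1`-valued `U₀` (in print: unitary matrices, «unitarily equivalent» [3] p. 24; (56)–(57)).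
[cite: Balaban1985Averaging, (56)–(57) p.27; Balaban1985BackgroundPropagators, (3.40) p.397] -/
theorem norm_trans [NormOneClass 𝔸] {U₀ : Site d → Fin d → 𝔸ˣ} (hU₀ : ∀ y κ, U₀ y κ ∈ U1 𝔸) (x x' : Site d) (X : 𝔸) :
    ‖trans U₀ x x' X‖ = ‖X‖ :=
  norm_conjR (hol_mem hU₀ _ _) X

variable [NormedAlgebra ℂ 𝔸]

/-- `R(U₀(Γ))` is real-linear ((56)–(57) of [3]). [cite: Balaban1985Averaging, (56)–(57) p.27] -/
theorem trans_smul (U₀ : Site d → Fin d → 𝔸ˣ) (x x' : Site d) (c : ℝ) (X : 𝔸) :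
    trans U₀ x x' (c • X) = c • trans U₀ x x' X :=
  conjR_smul_real _ _ _

/-- **The forward twin of (1.11)**: `(D^η_{U^u,μ}F^u)(x) = R(u(x))(D^η_{U,μ}F)(x)` for `F^u(z) = R(u(z))F(z)` and an arbitrary
units-valued site function `u` (the tree's `B8Ineq132.covDeriv_gaugeAct` is the backward-derivative statement printed as (1.11)).
[cite: Balaban1985RegularSpaces, (1.11) p.77, (1.1) p.76] -/
theorem covDerivFwd_gaugeAct (η : ℝ) (u : Site d → 𝔸ˣ) (U₀ : Site d → Fin d → 𝔸ˣ) (μ : Fin d) {F Fu : Site d → 𝔸}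
    (hF : ∀ z, Fu z = conjR (u z) (F z)) (x : Site d) :
    covDerivFwd η (gaugeAct u U₀) μ Fu x = conjR (u x) (covDerivFwd η U₀ μ F x) := by
  have hb : gaugeAct u U₀ x μ * u (x + e μ) = u x * U₀ x μ := by
    simp only [gaugeAct, inv_mul_cancel_right]
  unfold covDerivFwd
  rw [hF (x + e μ), hF x, conjR_conjR, hb, ← conjR_conjR, ← conjR_sub, ← conjR_smul_real]

end Transport

/-! ## §2 The covariant Hölder seminorms ‖A‖_β, ‖A‖_{1,β} of [4] (3.40) on the `ℤᵈ` carriers -/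

section Seminorm

variable {𝔸 : Type*} [NormedRing 𝔸]

/-- **«x, x′ : |x − x′| ≦ 1»** (η-scale) with `x ≠ x′`: the admissible pairs of (3.40) for a length function `len` on lattice
displacements — `0 < |x′ − x|` and `η|x′ − x| ≤ 1`. [cite: Balaban1985BackgroundPropagators, (3.40) p.397] -/
def AdmPair (η : ℝ) (len : Site d → ℝ) : Set (Site d × Site d) :=
  {p | 0 < len (p.2 - p.1) ∧ η * len (p.2 - p.1) ≤ 1}

/-- membership in `AdmPair`, unfolded. [cite: Balaban1985BackgroundPropagators, (3.40) p.397] -/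
theorem mem_admPair {η : ℝ} {len : Site d → ℝ} {p : Site d × Site d} :
    p ∈ AdmPair η len ↔ 0 < len (p.2 - p.1) ∧ η * len (p.2 - p.1) ≤ 1 := Iff.rfl

/-- **The Hölder quotient of (3.40)** for a site function `F` at the pair `(x, x′)`:
`|x′ − x|^{−β}|R(U₀(Γ_{x,x′}))F(x′) − F(x)|` on the η-lattice (`|x′ − x| = η·len(x′ − x)`).
[cite: Balaban1985BackgroundPropagators, (3.40) p.397] -/
def hquot (η β : ℝ) (len : Site d → ℝ) (U₀ : Site d → Fin d → 𝔸ˣ) (F : Site d → 𝔸) (p : Site d × Site d) : ℝ :=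
  ‖trans U₀ p.1 p.2 (F p.2) - F p.1‖ / (η * len (p.2 - p.1)) ^ β

/-- unfolding of `hquot`. [cite: Balaban1985BackgroundPropagators, (3.40) p.397] -/
theorem hquot_def (η β : ℝ) (len : Site d → ℝ) (U₀ : Site d → Fin d → 𝔸ˣ) (F : Site d → 𝔸) (p : Site d × Site d) :
    hquot η β len U₀ F p = ‖trans U₀ p.1 p.2 (F p.2) - F p.1‖ / (η * len (p.2 - p.1)) ^ β := rfl

/-- The quotients of (3.40) are non-negative on admissible pairs (`η ≥ 0`). [cite: Balaban1985BackgroundPropagators, (3.40) p.397] -/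
theorem hquot_nonneg {η : ℝ} (hη : 0 ≤ η) (β : ℝ) {len : Site d → ℝ} (U₀ : Site d → Fin d → 𝔸ˣ) (F : Site d → 𝔸)
    {p : Site d × Site d} (hp : p ∈ AdmPair η len) : 0 ≤ hquot η β len U₀ F p :=
  div_nonneg (norm_nonneg _) (Real.rpow_nonneg (mul_nonneg hη hp.1.le) β)

/-- **‖A‖_β of (3.40)** (first line): `max_μ sup_{x,x′:|x−x′|≦1} |x′ − x|^{−β}|R(U₀(Γ_{x,x′}))A_μ(x′) − A_μ(x)|` for a bond
field `A` on the `ℤᵈ` carriers, as the supremum over `(μ, admissible pair)` (value `0` for an unbounded or empty family, the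
convention of `B8Eq155JBound.wsup`). [cite: Balaban1985BackgroundPropagators, (3.40) p.397] -/
def holder0 (η β : ℝ) (len : Site d → ℝ) (U₀ : Site d → Fin d → 𝔸ˣ) (A : Site d → Fin d → 𝔸) : ℝ :=
  ⨆ q : Fin d × AdmPair η len, hquot η β len U₀ (fun z => A z q.1) q.2.1

variable [NormedAlgebra ℂ 𝔸]

/-- **‖A‖_{1,β} = ‖∇A‖_β of (3.40)** (second line): `max_{μ,ν} sup_{x,x′:|x−x′|≦1} |x′ − x|^{−β}|R(U₀(Γ_{x,x′}))(D_μA_ν)(x′) −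
(D_μA_ν)(x)|` with `D_μ = D^η_{U₀,μ}` the forward covariant derivative (1.1) (`B8Ineq132.covDerivFwd`), as the supremum over
`(μ, ν, admissible pair)`. [cite: Balaban1985BackgroundPropagators, (3.40) p.397; Balaban1985RegularSpaces, (1.36) p.82, (1.62) p.87] -/
def holder1 (η β : ℝ) (len : Site d → ℝ) (U₀ : Site d → Fin d → 𝔸ˣ) (A : Site d → Fin d → 𝔸) : ℝ :=
  ⨆ q : Fin d × Fin d × AdmPair η len, hquot η β len U₀ (covDerivFwd η U₀ q.1 (fun z => A z q.2.1)) q.2.2.1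

/-- «the smallest number C such that …» ([4] p. 397): a uniform bound `c ≥ 0` of the (1,β)-quotients bounds `‖A‖_{1,β}`.
[cite: Balaban1985BackgroundPropagators, p.397] -/
theorem holder1_le {η β : ℝ} {len : Site d → ℝ} {U₀ : Site d → Fin d → 𝔸ˣ} {A : Site d → Fin d → 𝔸} {c : ℝ} (hc : 0 ≤ c)
    (h : ∀ (μ ν : Fin d) (p : Site d × Site d), p ∈ AdmPair η len →
      hquot η β len U₀ (covDerivFwd η U₀ μ (fun z => A z ν)) p ≤ c) :
    holder1 η β len U₀ A ≤ c :=
  Real.iSup_le (fun q => h q.1 q.2.1 q.2.2.1 q.2.2.2) hc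

/-- Conversely every (1,β)-quotient of a uniformly bounded family is below `‖A‖_{1,β}`.
[cite: Balaban1985BackgroundPropagators, p.397] -/
theorem hquot_le_holder1 {η β : ℝ} {len : Site d → ℝ} {U₀ : Site d → Fin d → 𝔸ˣ} {A : Site d → Fin d → 𝔸} {c : ℝ}
    (h : ∀ (μ ν : Fin d) (p : Site d × Site d), p ∈ AdmPair η len →
      hquot η β len U₀ (covDerivFwd η U₀ μ (fun z => A z ν)) p ≤ c)
    (μ ν : Fin d) {p : Site d × Site d} (hp : p ∈ AdmPair η len) :
    hquot η β len U₀ (covDerivFwd η U₀ μ (fun z => A z ν)) p ≤ holder1 η β len U₀ A :=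
  le_ciSup (f := fun q : Fin d × Fin d × AdmPair η len =>
      hquot η β len U₀ (covDerivFwd η U₀ q.1 (fun z => A z q.2.1)) q.2.2.1)
    ⟨c, by rintro _ ⟨q, rfl⟩; exact h q.1 q.2.1 q.2.2.1 q.2.2.2⟩ (μ, ν, ⟨p, hp⟩)

/-- `‖A‖_{1,β} ≥ 0` (`η ≥ 0`). [cite: Balaban1985BackgroundPropagators, (3.40) p.397] -/
theorem holder1_nonneg {η : ℝ} (hη : 0 ≤ η) (β : ℝ) (len : Site d → ℝ) (U₀ : Site d → Fin d → 𝔸ˣ)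
    (A : Site d → Fin d → 𝔸) : 0 ≤ holder1 η β len U₀ A :=
  Real.iSup_nonneg fun q => hquot_nonneg hη β U₀ _ q.2.2.2

omit [NormedAlgebra ℂ 𝔸] in
/-- **Gauge invariance of the quotients** for `U1`-valued `u`: with `F^u(z) = R(u(z))F(z)`,
`|R(U₀^u(Γ_{x,x′}))F^u(x′) − F^u(x)| = |R(u(x))[R(U₀(Γ_{x,x′}))F(x′) − F(x)]| = |R(U₀(Γ_{x,x′}))F(x′) − F(x)|`.
[cite: Balaban1985BackgroundPropagators, (3.40) p.397; Balaban1985RegularSpaces, (1.17)–(1.18) p.78] -/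
theorem hquot_gaugeAct [NormOneClass 𝔸] (η β : ℝ) (len : Site d → ℝ) {u : Site d → 𝔸ˣ} (hu : ∀ x, u x ∈ U1 𝔸)
    (U₀ : Site d → Fin d → 𝔸ˣ) {F Fu : Site d → 𝔸} (hF : ∀ z, Fu z = conjR (u z) (F z)) (p : Site d × Site d) :
    hquot η β len (gaugeAct u U₀) Fu p = hquot η β len U₀ F p := by
  unfold hquot
  rw [trans_gaugeAct, hF p.2, hF p.1, conjR_conjR (u p.2)⁻¹, inv_mul_cancel, one_conjR, ← conjR_sub,
    norm_conjR (hu p.1)]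

/-- **GAUGE INVARIANCE OF ‖A‖_{1,β}**: `‖R(u)A‖^{U₀^u}_{1,β} = ‖A‖^{U₀}_{1,β}` for `U1`-valued `u` — the Hölder member of (1.36) is
invariant under the transformations (1.17)–(1.18), like the conditions (1.7)–(1.9) (p. 77 «These conditions are invariant with
respect to gauge transformations») — via `covDerivFwd_gaugeAct` and `hquot_gaugeAct`.
[cite: Balaban1985RegularSpaces, (1.36) p.82, (1.17)–(1.18) p.78, p.77; Balaban1985BackgroundPropagators, (3.40) p.397] -/
theorem holder1_gaugeAct [NormOneClass 𝔸] (η β : ℝ) (len : Site d → ℝ) {u : Site d → 𝔸ˣ} (hu : ∀ x, u x ∈ U1 𝔸)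
    (U₀ : Site d → Fin d → 𝔸ˣ) (A : Site d → Fin d → 𝔸) :
    holder1 η β len (gaugeAct u U₀) (fun z ν => conjR (u z) (A z ν)) = holder1 η β len U₀ A := by
  unfold holder1
  congr 1
  funext q
  exact hquot_gaugeAct η β len hu U₀ (covDerivFwd_gaugeAct η u U₀ q.1 (F := fun z => A z q.2.1) (fun _ => rfl)) _

omit [NormedAlgebra ℂ 𝔸] in
/-- Gauge invariance of `‖A‖_β` likewise. [cite: Balaban1985BackgroundPropagators, (3.40) p.397; Balaban1985RegularSpaces, (1.18) p.78] -/
theorem holder0_gaugeAct [NormOneClass 𝔸] (η β : ℝ) (len : Site d → ℝ) {u : Site d → 𝔸ˣ} (hu : ∀ x, u x ∈ U1 𝔸)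
    (U₀ : Site d → Fin d → 𝔸ˣ) (A : Site d → Fin d → 𝔸) :
    holder0 η β len (gaugeAct u U₀) (fun z ν => conjR (u z) (A z ν)) = holder0 η β len U₀ A := by
  unfold holder0
  congr 1
  funext q
  exact hquot_gaugeAct η β len hu U₀ (F := fun z => A z q.1) (fun _ => rfl) _

omit [NormedAlgebra ℂ 𝔸] in
/-- **Flat background**: at `U₀ = 1` the (1,β)-quotient is the plain quotient `|(∂_μA_ν)(x′) − (∂_μA_ν)(x)|/|x′ − x|^β` of
[2] (1.109) (`LatticeNorms.holderSeminormB5`'s shape). [cite: Balaban1984PropagatorsI, (1.109) p.35; Balaban1985BackgroundPropagators, p.397] -/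
theorem hquot_flat (η β : ℝ) (len : Site d → ℝ) (F : Site d → 𝔸) (p : Site d × Site d) :
    hquot η β len (1 : Site d → Fin d → 𝔸ˣ) F p = ‖F p.2 - F p.1‖ / (η * len (p.2 - p.1)) ^ β := by
  rw [hquot, trans_flat]

/-- **Under (1.41) the (1,β)-quotients are bounded** (so `‖A‖_{1,β}` is a genuine supremum): for `U1`-valued `U₀`,
`‖A‖ ≤ α₂(Lʲη)⁻¹`, `0 ≤ β`, `0 < η` and a length `≥ 1` on the admissible displacements, every quotient is at most
`2((Lʲη)⁻¹)²|∇^η_{U₀}A|_(−2)·η^{−β}`. [cite: Balaban1985RegularSpaces, (1.41) p.83; Balaban1985BackgroundPropagators, (3.40) p.397] -/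
theorem hquot_le_of_141 [NormOneClass 𝔸] {η : ℝ} (hη : 0 < η) {β : ℝ} (hβ : 0 ≤ β) {len : Site d → ℝ}
    (hlen : ∀ v : Site d, 0 < len v → 1 ≤ len v) {L : ℕ} (hL : 0 < L) (j : ℕ)
    {U₀ : Site d → Fin d → 𝔸ˣ} (h₀ : ∀ y κ, U₀ y κ ∈ U1 𝔸) {A : Site d → Fin d → 𝔸} {α₂ : ℝ}
    (h41 : ∀ y κ, ‖A y κ‖ ≤ α₂ * ((L : ℝ) ^ j * η)⁻¹) (μ ν : Fin d) {p : Site d × Site d} (hp : p ∈ AdmPair η len) :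
    hquot η β len U₀ (covDerivFwd η U₀ μ (fun z => A z ν)) p
      ≤ 2 * ((((L : ℝ) ^ j * η)⁻¹) ^ 2 * gradNorm2 η L j U₀ A) * (η ^ β)⁻¹ := by
  set G : ℝ := (((L : ℝ) ^ j * η)⁻¹) ^ 2 * gradNorm2 η L j U₀ A with hG
  have hGb : ∀ y, ‖covDerivFwd η U₀ μ (fun z => A z ν) y‖ ≤ G := fun y =>
    norm_covDerivFwd_le_gradNorm2 hη h₀ h41 hL j y μ ν
  have hnum : ‖trans U₀ p.1 p.2 (covDerivFwd η U₀ μ (fun z => A z ν) p.2) - covDerivFwd η U₀ μ (fun z => A z ν) p.1‖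
      ≤ 2 * G := by
    calc _ ≤ ‖trans U₀ p.1 p.2 (covDerivFwd η U₀ μ (fun z => A z ν) p.2)‖ + ‖covDerivFwd η U₀ μ (fun z => A z ν) p.1‖ :=
          norm_sub_le _ _
      _ ≤ G + G := by rw [norm_trans h₀]; exact add_le_add (hGb _) (hGb _)
      _ = 2 * G := by ring
  have hG0 : 0 ≤ 2 * G := by
    have : 0 ≤ G := mul_nonneg (sq_nonneg _) (gradNorm2_nonneg η L j U₀ A)
    linarith
  have hηβ : 0 < η ^ β := Real.rpow_pos_of_pos hη β
  have hden : η ^ β ≤ (η * len (p.2 - p.1)) ^ β := by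
    apply Real.rpow_le_rpow hη.le _ hβ
    have := hlen _ hp.1
    nlinarith
  unfold hquot
  rw [div_eq_mul_inv]
  exact mul_le_mul hnum (inv_anti₀ hηβ hden) (inv_nonneg.2 (hηβ.le.trans hden)) hG0

end Seminorm

/-! ### Two length functions on `ℤᵈ` (print's unspecified `|x′ − x|`) -/

section Lengths

/-- The contour-length reading of print's `|x′ − x|` in (3.40): `|v|₁ = Σ_μ |v_μ|` lattice units (= the number of bonds of
Γ_{x,x+v}). [cite: Balaban1985BackgroundPropagators, (3.40) p.397] -/
def l1Len (v : Site d) : ℝ := (l1 v : ℝ)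

/-- The Euclidean reading of print's `|x′ − x|` in (3.40): `|v| = (Σ_μ v_μ²)^{1/2}` lattice units. [cite: Balaban1985BackgroundPropagators, (3.40) p.397] -/
def euclidLen (v : Site d) : ℝ := Real.sqrt (∑ μ, ((v μ : ℝ)) ^ 2)

/-- The points of (3.40) lie on the lattice: a non-zero displacement has `ℓ¹` length `≥ 1` lattice unit (so «|x − x′| ≦ 1» on the
η-lattice leaves `η ≤ |x′ − x| ≤ 1`). [cite: Balaban1985BackgroundPropagators, (3.40) p.397] -/
theorem one_le_l1Len {v : Site d} (h : 0 < l1Len v) : 1 ≤ l1Len v := by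
  unfold l1Len at *
  exact_mod_cast (show 1 ≤ l1 v by exact_mod_cast h)

/-- The points of (3.40) lie on the lattice: a non-zero displacement has Euclidean length `≥ 1` lattice unit.
[cite: Balaban1985BackgroundPropagators, (3.40) p.397] -/
theorem one_le_euclidLen {v : Site d} (h : 0 < euclidLen v) : 1 ≤ euclidLen v := by
  unfold euclidLen at *
  have hS : 0 < ∑ μ, ((v μ : ℝ)) ^ 2 := Real.sqrt_pos.mp h
  -- some coordinate is non-zero, so the sum of integer squares is `≥ 1`
  obtain ⟨μ, -, hμ⟩ : ∃ μ ∈ (Finset.univ : Finset (Fin d)), (0 : ℝ) < ((v μ : ℝ)) ^ 2 :=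
    Finset.exists_lt_of_sum_lt (by simpa using hS)
  have hvμ : v μ ≠ 0 := by
    intro h0; rw [h0] at hμ; simp at hμ
  have h1 : (1 : ℝ) ≤ ((v μ : ℝ)) ^ 2 := by
    have : (1 : ℤ) ≤ (v μ) ^ 2 := by
      have := Int.one_le_abs hvμ
      nlinarith [sq_abs (v μ)]
    exact_mod_cast this
  have hle : ((v μ : ℝ)) ^ 2 ≤ ∑ κ, ((v κ : ℝ)) ^ 2 :=
    Finset.single_le_sum (f := fun κ => ((v κ : ℝ)) ^ 2) (fun κ _ => sq_nonneg _) (Finset.mem_univ μ)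
  calc (1 : ℝ) = Real.sqrt 1 := Real.sqrt_one.symm
    _ ≤ Real.sqrt (∑ κ, ((v κ : ℝ)) ^ 2) := Real.sqrt_le_sqrt (h1.trans hle)

end Lengths

end

end Literature.MathematicalPhysics.QuantumFieldTheory.Balaban1983to89.B9Eq340HolderZd
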